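import Summits.CriticalPhenomena.PercolationContinuityZ3.Theorems.PercNearOneGluingNoHeavyQuantGatedShiftOneLayer
import HarnessLib

/-!
# QUANT lane R8, T-DEC, cell L2 (`LawDec.SGCLightPair`), part 3: from a partial flow with the dichotomy to a flow of the whole layer

builds on p205010 (kernel theorem, internal audit signed; external expert review pending)

Support file (`--supports stmt-CriticalPhenomena-4575`), QUANT lane seat prim-quant-arm-2 (gen 37), rung R8 of
`run/shared/lean/prim/quant/LADDER.md`.  One theorem, standard axioms, no sorries.  This is the second half of typer g26's
`flowAtT_gatedShift_succ` (`…QuantGatedShiftOneLayer`) made GENERIC in the law: given a law `L ≥ 0` on `{0..M}` of mass `1` whose mean IS the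
target `S′` (`y·M ≤ S′`), a layer `j < M`, and a partial flow `φ` of its nonzero lows into mids with the five bookkeeping properties and the
DICHOTOMY "the unplaced low mass plus `L 0` fits (at the giant rate `y/(1−y)`) under a bound `G ≤ Σ_{j<h≤M} L h`" / "every nonzero low is fully
placed", the remainder `A = L − φ − (loads of φ)` has a flow — by `flowAtT_of_giants` in the first case and by the first-moment criterion
`flowAtT_of_moment` in the second (each placed mid pair has mean `≤ S′`, `usage_mid_mul_le`; `L` has mean exactly `S′`; so `A` has mean
`≥ S′·mass` and `0` as its only low) — and `isFlowAtT_of_partial` glues.  Used by part 4 (`…QuantSGCLightPairLayer`) with the pooled two-copy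
partial flow of part 2, at every layer of the gated product `gate_q(μ₁ ∗ {lo,hi;γ})`.

* **`LawDec.flowAtT_of_partial_dichotomy`** — the generic remainder theorem.

[this work]; the one-copy theorem and all flow pieces: typer g26 / this lane.  The gluing rows served [cite: KozmaNitzan2024, Conjecture 3 (p. 15)];
product measure [cite: Grimmett1999, §1.3 p. 10].
-/

noncomputable section

namespace Summit.CriticalPhenomena.PercolationContinuityZ3.Theorems

namespace Quant

open Finset

namespace LawDec

/-- **FROM A PARTIAL FLOW WITH THE DICHOTOMY TO A FLOW.**  `0 < y < 1`; `L ≥ 0`, `Σ_{t ≤ M} L t = 1`, `Σ t·L t = S′ > 0`, `y·M ≤ S′`;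
`j < M`; `φ ≥ 0` charging only (nonzero low `t ≤ j`, `2t < S′`; admissible absorber `k ≤ M`), vanishing unless `1 ≤ t ≤ j`, `2t < S′`,
`1 ≤ k ≤ j`, loading every column `1 ≤ k ≤ j` by at most `L k`, shipping from every nonzero low at most its mass, and EITHER
`y/(1−y)·(L 0 + Σ_{nonzero lows t}(L t − Σ_k φ t k)) ≤ G` for some `G ≤ Σ_{j<h≤M} L h` OR every nonzero low fully placed.  Then
`FlowAtT y S′ j M L`. [this work] -/
theorem flowAtT_of_partial_dichotomy (y S' G : ℝ) (j M : ℕ) (L : ℕ → ℝ) (φ : ℕ → ℕ → ℝ) (hy0 : 0 < y) (hy1 : y < 1)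
    (hS' : 0 < S') (hL0 : ∀ t, 0 ≤ L t) (hL1 : ∑ t ∈ Finset.range (M + 1), L t = 1)
    (hLmean : ∑ t ∈ Finset.range (M + 1), (t : ℝ) * L t = S') (hta : y * (M : ℝ) ≤ S') (hjM : j < M)
    (hφ0 : ∀ t k, 0 ≤ φ t k)
    (hφsupp : ∀ t k, 0 < φ t k → t ≤ j ∧ 2 * (t : ℝ) < S' ∧ k ≤ M ∧ (j + 1 ≤ k ∨ S' < (t : ℝ) + k))
    (hφz : ∀ t k, ¬ ((1 ≤ t ∧ t ≤ j ∧ 2 * (t : ℝ) < S') ∧ 1 ≤ k ∧ k ≤ j) → φ t k = 0)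
    (hcolφ : ∀ k, 1 ≤ k → k ≤ j → ∑ t ∈ Finset.range (j + 1), usage y S' j t k * φ t k ≤ L k)
    (hrows : ∀ t, (1 ≤ t ∧ t ≤ j ∧ 2 * (t : ℝ) < S') → ∑ k ∈ Finset.range (M + 1), φ t k ≤ L t)
    (hdich : (y / (1 - y) * (L 0 + ∑ t ∈ Finset.range (j + 1),
          (if (1 ≤ t ∧ t ≤ j ∧ 2 * (t : ℝ) < S') then L t - ∑ k ∈ Finset.range (M + 1), φ t k else 0)) ≤ G ∧
        G ≤ ∑ h ∈ Finset.Ico (j + 1) (M + 1), L h) ∨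
      (∀ t, (1 ≤ t ∧ t ≤ j ∧ 2 * (t : ℝ) < S') → ∑ k ∈ Finset.range (M + 1), φ t k = L t)) :
    FlowAtT y S' j M L := by
  classical
  have h1y : 0 < 1 - y := by linarith
  have htaL : ∀ k : ℕ, k ≤ M → y * (k : ℝ) ≤ S' := by
    intro k hk
    have : (k : ℝ) ≤ M := by exact_mod_cast hk
    nlinarith
  /- ### the remainder -/
  set A : ℕ → ℝ := fun t => L t - ∑ k ∈ Finset.range (M + 1), φ t k
    - ∑ a ∈ Finset.range (j + 1), usage y S' j a t * φ a t with hA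
  -- column sums into a low atom and row sums out of a non-low vanish
  have hcol_low : ∀ t, t ≤ j → 2 * (t : ℝ) < S' → ∑ a ∈ Finset.range (j + 1), usage y S' j a t * φ a t = 0 := by
    intro t htj htlow
    refine Finset.sum_eq_zero fun a _ => ?_
    rcases (hφ0 a t).eq_or_lt with hz | hp
    · rw [← hz, mul_zero]
    · exfalso
      obtain ⟨_, halow, _, hadm⟩ := hφsupp a t hp
      rcases hadm with h1 | h2
      · omega
      · linarith
  have hrow_abs : ∀ t, ¬ (1 ≤ t ∧ t ≤ j ∧ 2 * (t : ℝ) < S') → ∑ k ∈ Finset.range (M + 1), φ t k = 0 := by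
    intro t ht
    exact Finset.sum_eq_zero fun k _ => hφz t k (fun hc => ht hc.1)
  have hA0val : A 0 = L 0 := by
    simp only [hA]
    rw [hrow_abs 0 (fun h => absurd h.1 (by omega))]
    have : ∑ a ∈ Finset.range (j + 1), usage y S' j a 0 * φ a 0 = 0 :=
      Finset.sum_eq_zero fun a _ => by rw [hφz a 0 (fun h => absurd h.2.1 (by omega)), mul_zero]
    rw [this]; ring
  have hAlow : ∀ a, (1 ≤ a ∧ a ≤ j ∧ 2 * (a : ℝ) < S') → A a = L a - ∑ k ∈ Finset.range (M + 1), φ a k := by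
    intro a hla
    simp only [hA]
    rw [hcol_low a hla.2.1 hla.2.2, sub_zero]
  have hAgiant : ∀ t, j + 1 ≤ t → A t = L t := by
    intro t ht
    simp only [hA]
    rw [hrow_abs t (fun h => absurd h.2.1 (by omega))]
    have : ∑ a ∈ Finset.range (j + 1), usage y S' j a t * φ a t = 0 :=
      Finset.sum_eq_zero fun a _ => by rw [hφz a t (fun hc => absurd hc.2.2 (by omega)), mul_zero]
    rw [this]; ring
  have hA_nn : ∀ t, 0 ≤ A t := by
    intro t
    by_cases ht0 : t = 0
    · rw [ht0, hA0val]; exact hL0 0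
    by_cases hlt : (1 ≤ t ∧ t ≤ j ∧ 2 * (t : ℝ) < S')
    · rw [hAlow t hlt]; linarith [hrows t hlt]
    by_cases htj : t ≤ j
    · simp only [hA]
      rw [hrow_abs t hlt, sub_zero]
      linarith [hcolφ t (by omega) htj]
    · rw [hAgiant t (by omega)]; exact hL0 t
  /- ### the remainder has a flow -/
  have hAflow : FlowAtT y S' j M A := by
    rcases hdich with ⟨hgiants, hG⟩ | hplaced
    · -- every remaining low rides the giants
      refine flowAtT_of_giants y S' j M A hy0 hy1 hA_nn ?_
      have hlhs : ∑ l ∈ Finset.range (j + 1), (if 2 * (l : ℝ) < S' then A l else 0)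
          = L 0 + ∑ a ∈ Finset.range (j + 1),
              (if (1 ≤ a ∧ a ≤ j ∧ 2 * (a : ℝ) < S') then L a - ∑ k ∈ Finset.range (M + 1), φ a k else 0) := by
        rw [Finset.sum_range_succ', Finset.sum_range_succ' (fun a =>
          (if (1 ≤ a ∧ a ≤ j ∧ 2 * (a : ℝ) < S') then L a - ∑ k ∈ Finset.range (M + 1), φ a k else 0))]
        simp only [Nat.cast_zero, mul_zero]
        rw [if_pos hS', hA0val, if_neg (fun h => absurd h.1 (by omega)), add_zero]
        have e : ∀ l ∈ Finset.range j, (if 2 * (((l + 1 : ℕ)) : ℝ) < S' then A (l + 1) else 0)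
            = (if (1 ≤ l + 1 ∧ l + 1 ≤ j ∧ 2 * (((l + 1 : ℕ)) : ℝ) < S') then
                L (l + 1) - ∑ k ∈ Finset.range (M + 1), φ (l + 1) k else 0) := by
          intro l hl
          rw [Finset.mem_range] at hl
          by_cases hc : 2 * (((l + 1 : ℕ)) : ℝ) < S'
          · have hla : 1 ≤ l + 1 ∧ l + 1 ≤ j ∧ 2 * (((l + 1 : ℕ)) : ℝ) < S' := ⟨by omega, by omega, hc⟩
            rw [if_pos hc, if_pos hla, hAlow (l + 1) hla]
          · rw [if_neg hc, if_neg (fun h => hc h.2.2)]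
        rw [Finset.sum_congr rfl e]; ring
      have hrhs : ∑ h ∈ Finset.Ico (j + 1) (M + 1), A h = ∑ h ∈ Finset.Ico (j + 1) (M + 1), L h :=
        Finset.sum_congr rfl fun h hh => hAgiant h (Finset.mem_Ico.1 hh).1
      rw [hlhs, hrhs]
      exact le_trans hgiants hG
    · -- every nonzero low is placed: the first-moment criterion ships the atom `0`
      refine flowAtT_of_moment y S' j M A hy0 hy1 hS' hA_nn ?_ hta ?_
      · intro l hl1 hlJ hllow
        rw [hAlow l ⟨hl1, hlJ, hllow⟩, hplaced l ⟨hl1, hlJ, hllow⟩]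
        ring
      · have hLpart : ∑ t ∈ Finset.range (M + 1), ((t : ℝ) - S') * L t = 0 := by
          have e : ∑ t ∈ Finset.range (M + 1), ((t : ℝ) - S') * L t
              = ∑ t ∈ Finset.range (M + 1), (t : ℝ) * L t - S' * ∑ t ∈ Finset.range (M + 1), L t := by
            rw [Finset.mul_sum, ← Finset.sum_sub_distrib]
            exact Finset.sum_congr rfl fun t _ => by ring
          rw [e, hLmean, hL1]; ring
        have hrowpart : ∑ t ∈ Finset.range (M + 1), ((t : ℝ) - S') * ∑ k ∈ Finset.range (M + 1), φ t k
            = ∑ a ∈ Finset.range (j + 1), ∑ k ∈ Finset.range (M + 1), ((a : ℝ) - S') * φ a k := by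
          have hsub : ∑ a ∈ Finset.range (j + 1), ((a : ℝ) - S') * ∑ k ∈ Finset.range (M + 1), φ a k
              = ∑ t ∈ Finset.range (M + 1), ((t : ℝ) - S') * ∑ k ∈ Finset.range (M + 1), φ t k :=
            Finset.sum_subset (Finset.range_mono (show j + 1 ≤ M + 1 by omega)) (fun t _ ht => by
              rw [Finset.mem_range] at ht
              rw [hrow_abs t (fun h => absurd h.2.1 (by omega)), mul_zero])
          rw [← hsub]
          exact Finset.sum_congr rfl fun a _ => by rw [Finset.mul_sum]
        have hcolpart : ∑ t ∈ Finset.range (M + 1), ((t : ℝ) - S') * ∑ a ∈ Finset.range (j + 1), usage y S' j a t * φ a t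
            = ∑ a ∈ Finset.range (j + 1), ∑ k ∈ Finset.range (M + 1), ((k : ℝ) - S') * (usage y S' j a k * φ a k) := by
          have e : ∀ t ∈ Finset.range (M + 1), ((t : ℝ) - S') * ∑ a ∈ Finset.range (j + 1), usage y S' j a t * φ a t
              = ∑ a ∈ Finset.range (j + 1), ((t : ℝ) - S') * (usage y S' j a t * φ a t) :=
            fun t _ => by rw [Finset.mul_sum]
          rw [Finset.sum_congr rfl e, Finset.sum_comm]
        have hneg := sum_moment_partial_nonpos y S' j M φ hy0 hy1 hφ0 (fun a k hp => by
          obtain ⟨_, halow, hkM, hadm⟩ := hφsupp a k hp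
          have hkJ : k ≤ j := by
            by_contra hc
            exact absurd (hφz a k (fun h => hc h.2.2)) (ne_of_gt hp)
          have hcomp : S' < (a : ℝ) + k := by
            rcases hadm with h1 | h2
            · omega
            · exact h2
          exact ⟨halow, hkJ, hcomp, htaL k hkM⟩)
        rw [Finset.sum_congr rfl (fun a _ => Finset.sum_add_distrib), Finset.sum_add_distrib] at hneg
        have hexp : ∑ t ∈ Finset.range (M + 1), ((t : ℝ) - S') * A t
            = ∑ t ∈ Finset.range (M + 1), ((t : ℝ) - S') * L t
              - ∑ t ∈ Finset.range (M + 1), ((t : ℝ) - S') * ∑ k ∈ Finset.range (M + 1), φ t k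
              - ∑ t ∈ Finset.range (M + 1), ((t : ℝ) - S') * ∑ a ∈ Finset.range (j + 1), usage y S' j a t * φ a t := by
          rw [← Finset.sum_sub_distrib, ← Finset.sum_sub_distrib]
          exact Finset.sum_congr rfl fun t _ => by simp only [hA]; ring
        have hfin : 0 ≤ ∑ t ∈ Finset.range (M + 1), ((t : ℝ) - S') * A t := by
          rw [hexp, hLpart, hrowpart, hcolpart]; linarith
        have e2 : ∑ t ∈ Finset.range (M + 1), ((t : ℝ) - S') * A t
            = ∑ t ∈ Finset.range (M + 1), (t : ℝ) * A t - S' * ∑ t ∈ Finset.range (M + 1), A t := by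
          rw [Finset.mul_sum, ← Finset.sum_sub_distrib]
          exact Finset.sum_congr rfl fun t _ => by ring
        rw [e2] at hfin
        linarith
  /- ### assembly -/
  obtain ⟨g, hg⟩ := hAflow
  have hgI : IsFlowAtT y S' j M A g := hg
  rw [hA] at hgI
  exact ⟨fun l h => φ l h + g l h, isFlowAtT_of_partial hφ0 hφsupp hgI⟩

end LawDec

end Quant

end Summit.CriticalPhenomena.PercolationContinuityZ3.Theorems
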